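import Summits.Ventures.CertifiedManyBodySolver.Downfold.TppSeamOrder
import Summits.Ventures.CertifiedManyBodySolver.Downfold.BoxesCCOC
import HarnessLib

/-!
# The ORDER word of object M AT THE BOX'S OWN FILLING: one sourced object-E floor + the canonical S2
# window, no chemical-potential interval

Venture CertifiedManyBodySolver, cell `pub/hubbard-downfold` (stage S1 ↔ S2 seam), seat hubbard-downfold-mod-1;
namespace `Summit.Ventures.CertifiedManyBodySolver.Downfold`. Sequel of `TppSeamOrder.lean` (p484547), which reads
the Literature's grand-canonical pair-amplitude ceiling (`DWaveSourceEnergyDensityTPPTransport` §4) verbatim and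
therefore carries a `2|μ − μ₀|` cost for the material's UNKNOWN chemical potential `μ`. A material box carries the
FILLING `n`, and the variational argument runs just as well against states of density `n`: for a
translation-invariant `σ` with `σ.density = n` whose source-free object-M mean energy is within `ε` of the
canonical minimum `e^M_n(p)` (`FermionInteraction.tiGroundEnergyDensityAt`), the sourced grand-canonical
principle AT THE ANCHOR'S OWN `μ₀` — a free parameter now: no transport in `μ`, no interval — gives
`h·e_P(σ) = E_M(σ) − μ₀ n − E^{src}_{μ₀,h}(σ) ≤ [e^M_n(p) + ε] − μ₀ n − e^M_src(p; μ₀, h)`; the fixed-filling seam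
(`TppSeamFilling`, kinematic constant `16/π²`) caps `e^M_n(p) ≤ R + (16/π²)m` from the S2 `_word_Icc` window on
the box's `(U/t, tp/t, n)` cell, and the sourced seam (§3 of the Literature file) floors
`e^M_src ≥ e_src(p tp/t, p U/t, μ₀, h) − (16/π²)m ≥ lo − 4·eS.dev t'₀ − max 0 (U₀ − eU.lo) − (16/π²)m` — ONE
sourced floor `lo ≤ e_src(t'₀, U₀, μ₀, h)` transported along `t'` (`4`-Lipschitz,
`dWaveSourceEnergyDensityTT'_ge_of_ge_tp`) and DOWNWARD in `U` only (`e_src` is non-decreasing and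
`1`-Lipschitz in `U`, `dWaveSourceEnergyDensityTT'_mono_U` / `…_le_add_sub_U`: an anchor at or below the
box's lower `U/t` edge costs nothing). Hence

* `holdsOn_pairAmplitude_le_of_anchor_filling` — on `B`: every translation-invariant `ε`-near canonical
  minimiser `σ` of object M at the member's couplings AND the member's filling has
  `e_P(σ) ≤ (R − μ₀·n − lo + 4·eS.dev t'₀ + max 0 (U₀ − eU.lo) + (32/π²)·m + ε)/h`;
* `holdsOn_pairAmplitude_lt_of_anchor_filling_near` — THE ABSENT(`< m₀`) WORD at the box's own fillings:
  `R − lo + 4·eS.dev t'₀ + max 0 (U₀ − eU.lo) + (32/π²)·m − min (μ₀·n.lo) (μ₀·n.hi) < h·m₀` ⇒ no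
  translation-invariant canonical minimiser of object M on the box has `d`-wave pair amplitude `≥ m₀`;
* on `boxLa214M_M15` (BoxesLa214, p478802) with the anchor at the LOWER `U/t` EDGE
  `(t'₀, U₀) = (−1/10, 63/10)`: box cost `4·(7/100) + 0 + (32/π²)(7/50) ≤ 0.734 t`
  (`boxLa214M_M15_pairAmplitude_le_anchorLo_filling`, `la214M_M15_orderSeam_filling_cost_le`) — against
  `4.714 t` for the single-anchor `μ`-form (`la214M_M15_orderSeam_cost_le`).

WHAT S2 SUPPLIES for such a word: (i) the canonical `_word_Icc` window `[L, R]` on the M cell (exists in kind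
today: hubbard-fast cell/box words), (ii) ONE sourced floor `lo ≤ e_src(t'₀, U₀, μ₀, h)` with `U₀ ≤` the cell's
lower `U/t` edge, at a chemical potential `μ₀` OF ITS CHOICE — the Legendre gap `R − μ₀ n − e_GC(μ₀) ≥ 0` is
the price of a badly chosen `μ₀`, paid INSIDE the bound, never a hypothesis; (iii) `U`-cells if the window
`R − L` over `U/t ∈ [6.3, 13.7]` is too wide (glue by `HoldsOn.of_refines`).

Everything here is PROVED; no new definition. HONEST FRAMING: variational, ceiling/ABSENT side only;
`e_P(σ)` of translation-invariant near-minimisers is the surrogate of the (undefined in the tree) torus-limit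
order parameter of object M; nothing here floors order or bears on `T_c`; the box values are screening-grade
S1 output; no number about any material is certified by this file.
-/

noncomputable section

namespace Summit.Ventures.CertifiedManyBodySolver.Downfold

open NonemptyInterval Literature.MathematicalPhysics.QuantumLattice
  Literature.MathematicalPhysics.QuantumLattice.ThermodynamicLimit Literature.Probability.LatticeModels

/-- For `n ∈ [lo, hi]`: `min (μ₀·lo) (μ₀·hi) ≤ μ₀·n` (a linear function attains its minimum at an end).
[folklore] -/
theorem min_mul_le_mul_of_mem_Icc (μ₀ : ℝ) {n lo hi : ℝ} (hn : n ∈ Set.Icc lo hi) :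
    min (μ₀ * lo) (μ₀ * hi) ≤ μ₀ * n := by
  rcases le_total 0 μ₀ with h0 | h0
  · exact (min_le_left _ _).trans (mul_le_mul_of_nonneg_left hn.1 h0)
  · exact (min_le_right _ _).trans (mul_le_mul_of_nonpos_left hn.2 h0)

/-- **A sourced floor moves DOWN in `U` at bounded cost and UP for free**: `lo ≤ e_src(t', U₀, μ, h)` and
`Ulo ≤ U` give `lo − max 0 (U₀ − Ulo) ≤ e_src(t', U, μ, h)` (`e_src` is non-decreasing and `1`-Lipschitz in
`U`). [cite: Ruelle1969, §3.4] -/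
theorem dWaveSourceEnergyDensityTT'_ge_of_ge_U_lowerEdge {t' U₀ μ h lo Ulo U : ℝ}
    (hlo : lo ≤ dWaveSourceEnergyDensityTT' t' U₀ μ h) (hU : Ulo ≤ U) :
    lo - max 0 (U₀ - Ulo) ≤ dWaveSourceEnergyDensityTT' t' U μ h := by
  rcases le_total U₀ U with hle | hle
  · have h1 := dWaveSourceEnergyDensityTT'_mono_U t' μ h hle
    linarith [le_max_left (0 : ℝ) (U₀ - Ulo)]
  · have h1 := dWaveSourceEnergyDensityTT'_le_add_sub_U t' μ h hle
    have h2 : U₀ - U ≤ max 0 (U₀ - Ulo) := le_max_of_le_right (by linarith)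
    linarith

/-- **THE ORDER WORD AT THE BOX'S OWN FILLING.** Let `B` carry entries `eU, eS, eSS, eN` for `U/t`, `tp/t`,
`tpp/t`, `n` with `eU.lo ≥ 0`, `0 < eN.lo`, `eN.hi < 2`; let S2 state the canonical `_word_Icc` window
`∀ θ ∈ Set.Icc (s2Lo eU eS eN) (s2Hi eU eS eN), L ≤ energyDensityTT' 1 (θ 1) (θ 0) (θ 2) ≤ R`; and let ONE
sourced floor be certified at an anchor, `lo ≤ e_src(t'₀, U₀, μ₀, h)`, `h > 0`. Then on `B`: for every `ε`
and every translation-invariant `σ` with `σ.density = p n` whose source-free object-M mean energy at the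
member's couplings is within `ε` of the canonical minimum `e^M_{p n}`,
`e_P(σ) ≤ (R − μ₀·(p n) − lo + 4·eS.dev t'₀ + max 0 (U₀ − eU.lo) + (32/π²)·m + ε)/h`,
`m = max |eSS.lo| |eSS.hi|`. [cite: KomaTasaki1994, §1] -/
theorem holdsOn_pairAmplitude_le_of_anchor_filling {B : OneBandBox} {eU eS eSS eN : Entry}
    (hU : B .UOverT = some eU) (hS : B .tpOverT = some eS) (hSS : B .tppOverT = some eSS)
    (hN : B .filling = some eN) (hU0 : 0 ≤ eU.encl.fst) (hN0 : 0 < eN.encl.fst) (hN2 : eN.encl.snd < 2)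
    {L R : ℝ}
    (hE : ∀ θ ∈ Set.Icc (s2Lo eU eS eN) (s2Hi eU eS eN),
      L ≤ energyDensityTT' 1 (θ 1) (θ 0) (θ 2) ∧ energyDensityTT' 1 (θ 1) (θ 0) (θ 2) ≤ R)
    {t'₀ U₀ μ₀ h lo : ℝ} (hh : 0 < h) (hlo : lo ≤ dWaveSourceEnergyDensityTT' t'₀ U₀ μ₀ h) :
    HoldsOn (fun p : OneBandCoord → ℝ => ∀ (ε : ℝ) (σ : InfVolFermionState 2), σ.IsTranslationInvariant →
      σ.density = p .filling →
      σ.meanEnergy (hubbardTT'T''FermionInteraction 1 (p .tpOverT) (p .tppOverT) (p .UOverT)) 2 ≤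
        (hubbardTT'T''FermionInteraction 1 (p .tpOverT) (p .tppOverT) (p .UOverT)).tiGroundEnergyDensityAt 2
          (p .filling) + ε →
      σ.meanEnergy (pairSourceInteraction dWaveFormFactor) 1 ≤
        (R - μ₀ * p .filling - lo + 4 * eS.dev t'₀ + max 0 (U₀ - ((eU.encl.fst : ℚ) : ℝ)) +
          32 / Real.pi ^ 2 * ((max |eSS.encl.fst| |eSS.encl.snd| : ℚ) : ℝ) + ε) / h) B := by
  intro p hp ε σ hσ hρ hε
  -- (1) the canonical cap on the box (fixed-filling seam, kinematic constant)
  have hcap := (holdsOn_tiGroundEnergyDensityAt_objectM_kinematic hU hS hSS hN hU0 hN0 hN2 hE p hp).2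
  -- (2) the sourced grand-canonical principle at (p, μ₀, h) for the state σ
  have hvar := (hubbardTT'T''SourcedInteraction 1 (p .tpOverT) (p .tppOverT) (p .UOverT) μ₀
    dWaveFormFactor h).tiGroundEnergyDensity_le_meanEnergy 2 hσ
  rw [σ.meanEnergy_hubbardTT'T''Sourced 1 (p .tpOverT) (p .tppOverT) (p .UOverT) μ₀ dWaveFormFactor h,
    hρ] at hvar
  -- (3) the sourced floor: anchor → member's t' (4-Lipschitz) → member's U (down only) → object M (seam)
  have h1 : lo - 4 * |p .tpOverT - t'₀| ≤ dWaveSourceEnergyDensityTT' (p .tpOverT) U₀ μ₀ h :=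
    dWaveSourceEnergyDensityTT'_ge_of_ge_tp U₀ μ₀ h hlo
  have hUmem := mem_ratCast_iff.1 (hp _ _ hU)
  have h2 := dWaveSourceEnergyDensityTT'_ge_of_ge_U_lowerEdge h1 hUmem.1
  have h3 := tiGroundEnergyDensity_tppSourced_ge_of_le h2 (p .tppOverT)
  have h4 : |p .tppOverT| ≤ ((max |eSS.encl.fst| |eSS.encl.snd| : ℚ) : ℝ) := Entry.abs_le_of_mem (hp _ _ hSS)
  have h5 : |p .tpOverT - t'₀| ≤ eS.dev t'₀ := Entry.abs_sub_le_dev_of_mem (hp _ _ hS) t'₀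
  have hπ : 0 ≤ 16 / Real.pi ^ 2 := by positivity
  rw [le_div_iff₀ hh]
  have h32 : 32 / Real.pi ^ 2 * ((max |eSS.encl.fst| |eSS.encl.snd| : ℚ) : ℝ) =
      2 * (16 / Real.pi ^ 2 * ((max |eSS.encl.fst| |eSS.encl.snd| : ℚ) : ℝ)) := by ring
  rw [h32]
  nlinarith [mul_le_mul_of_nonneg_left h4 hπ]

/-- **THE ABSENT(`< m₀`) WORD AT THE BOX'S OWN FILLINGS.** Same data and a threshold `m₀` with
`R − lo + 4·eS.dev t'₀ + max 0 (U₀ − eU.lo) + (32/π²)·m − min (μ₀·eN.lo) (μ₀·eN.hi) < h·m₀`. Then on `B`: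
NO translation-invariant canonical minimiser of object M (`σ.density = p n`, mean energy `= e^M_{p n}`) at any
member's couplings has `d`-wave pair amplitude `≥ m₀` — read off ONE sourced object-E floor and ONE canonical
S2 window, with no chemical-potential interval. [cite: KomaTasaki1994, §1] -/
theorem holdsOn_pairAmplitude_lt_of_anchor_filling_near {B : OneBandBox} {eU eS eSS eN : Entry}
    (hU : B .UOverT = some eU) (hS : B .tpOverT = some eS) (hSS : B .tppOverT = some eSS)
    (hN : B .filling = some eN) (hU0 : 0 ≤ eU.encl.fst) (hN0 : 0 < eN.encl.fst) (hN2 : eN.encl.snd < 2)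
    {L R : ℝ}
    (hE : ∀ θ ∈ Set.Icc (s2Lo eU eS eN) (s2Hi eU eS eN),
      L ≤ energyDensityTT' 1 (θ 1) (θ 0) (θ 2) ∧ energyDensityTT' 1 (θ 1) (θ 0) (θ 2) ≤ R)
    {t'₀ U₀ μ₀ h lo m₀ : ℝ} (hh : 0 < h) (hlo : lo ≤ dWaveSourceEnergyDensityTT' t'₀ U₀ μ₀ h)
    (hnear : R - lo + 4 * eS.dev t'₀ + max 0 (U₀ - ((eU.encl.fst : ℚ) : ℝ)) +
        32 / Real.pi ^ 2 * ((max |eSS.encl.fst| |eSS.encl.snd| : ℚ) : ℝ) -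
        min (μ₀ * ((eN.encl.fst : ℚ) : ℝ)) (μ₀ * ((eN.encl.snd : ℚ) : ℝ)) < h * m₀) :
    HoldsOn (fun p : OneBandCoord → ℝ => ∀ σ : InfVolFermionState 2, σ.IsTranslationInvariant →
      σ.density = p .filling →
      σ.meanEnergy (hubbardTT'T''FermionInteraction 1 (p .tpOverT) (p .tppOverT) (p .UOverT)) 2 =
        (hubbardTT'T''FermionInteraction 1 (p .tpOverT) (p .tppOverT) (p .UOverT)).tiGroundEnergyDensityAt 2
          (p .filling) →
      σ.meanEnergy (pairSourceInteraction dWaveFormFactor) 1 < m₀) B := by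
  intro p hp σ hσ hρ hmin
  have hk := holdsOn_pairAmplitude_le_of_anchor_filling hU hS hSS hN hU0 hN0 hN2 hE hh hlo p hp 0 σ hσ hρ
    (by rw [add_zero]; exact hmin.le)
  have hn := min_mul_le_mul_of_mem_Icc μ₀ (mem_ratCast_iff.1 (hp _ _ hN))
  refine hk.trans_lt ?_
  rw [div_lt_iff₀ hh]
  linarith

/-- **La-214 M15, object M, ANCHOR AT THE LOWER `U/t` EDGE** `(t'₀, U₀) = (−1/10, 63/10)`, any `μ₀`: an S2
window `[L, R]` on the M cell `Set.Icc ![63/10, −17/100, 171/200] ![137/10, −3/100, 179/200]` and ONE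
sourced floor `lo ≤ e_src(−1/10, 63/10, μ₀, h)` give, on `boxLa214M_M15`, for every translation-invariant
`ε`-near canonical minimiser at the member's couplings and filling,
`e_P(σ) ≤ (R − μ₀·n − lo + 4·(7/100) + (32/π²)(7/50) + ε)/h` — NO `U` cost, NO `μ` interval.
[cite: KomaTasaki1994, §1] -/
theorem boxLa214M_M15_pairAmplitude_le_anchorLo_filling {L R μ₀ h lo : ℝ}
    (hE : ∀ θ ∈ Set.Icc (![63/10, -17/100, 171/200] : Fin 3 → ℝ) ![137/10, -3/100, 179/200],
      L ≤ energyDensityTT' 1 (θ 1) (θ 0) (θ 2) ∧ energyDensityTT' 1 (θ 1) (θ 0) (θ 2) ≤ R)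
    (hh : 0 < h) (hlo : lo ≤ dWaveSourceEnergyDensityTT' (-1/10) (63/10) μ₀ h) :
    HoldsOn (fun p : OneBandCoord → ℝ => ∀ (ε : ℝ) (σ : InfVolFermionState 2), σ.IsTranslationInvariant →
      σ.density = p .filling →
      σ.meanEnergy (hubbardTT'T''FermionInteraction 1 (p .tpOverT) (p .tppOverT) (p .UOverT)) 2 ≤
        (hubbardTT'T''FermionInteraction 1 (p .tpOverT) (p .tppOverT) (p .UOverT)).tiGroundEnergyDensityAt 2
          (p .filling) + ε →
      σ.meanEnergy (pairSourceInteraction dWaveFormFactor) 1 ≤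
        (R - μ₀ * p .filling - lo + 4 * (7/100 : ℝ) + 32 / Real.pi ^ 2 * (7/50 : ℝ) + ε) / h)
      boxLa214M_M15 := by
  have hk := holdsOn_pairAmplitude_le_of_anchor_filling (B := boxLa214M_M15) (eU := la214M_M15_U)
    (eS := la214M_M15_tp) (eSS := la214M_M15_tpp) (eN := la214_M15_n) rfl rfl rfl rfl
    (by rw [la214M_M15_U, Entry.encl_ofEnds_fst]; norm_num)
    (by rw [la214_M15_n, Entry.encl_ofEnds_fst]; norm_num)
    (by rw [la214_M15_n, Entry.encl_ofEnds_snd]; norm_num)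
    (L := L) (R := R) (by rw [la214M_M15_s2Lo, la214M_M15_s2Hi]; exact hE) hh hlo
  rw [la214M_M15_tp_dev_mid, la214M_M15_tpp_abs] at hk
  have hc : (((7/50 : ℚ)) : ℝ) = (7/50 : ℝ) := by norm_num
  have hu : max 0 ((63/10 : ℝ) - (((la214M_M15_U.encl.fst : ℚ)) : ℝ)) = 0 := by
    rw [la214M_M15_U, Entry.encl_ofEnds_fst]; norm_num
  rw [hc, hu] at hk
  simp only [add_zero] at hk
  exact hk

/-- **The fixed-filling box cost of `boxLa214M_M15` with the anchor at the lower `U/t` edge is at most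
`0.734 t`**: `4·(7/100) + (32/π²)(7/50) ≤ 0.28 + 0.454` — against `4.714` for the single-anchor `μ`-form
(`la214M_M15_orderSeam_cost_le`): no `U/t` half-width and no `μ` transport are paid. [folklore] -/
theorem la214M_M15_orderSeam_filling_cost_le :
    4 * (7/100 : ℝ) + 32 / Real.pi ^ 2 * (7/50 : ℝ) ≤ 0.734 := by
  have h := la214M_M15_orderSeam_cost_le
  linarith

/-! ### Appendix (2026-08-27, append-only): OBJECT E — the order word on the boxes S2 actually certifies today

For an object-E box the `tpp/t` entry is `[0, 0]` (`m = 0`), the member's `t–t'–t''` interaction IS the `t–t'` interaction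
(`hubbardTT'T''FermionInteraction_zero`) and the canonical minimum is the certified `energyDensityTT'`
(`tiGroundEnergyDensityAt_hubbardTT'T''_zero`). So the theorem above reads, with NO model-form residual:
ONE sourced floor `lo ≤ e_src(t'₀, U₀, μ₀, h)` (anchor at or below the box's lower `U/t_eff` edge) + the box's own S2
window cap `R` ⇒ every translation-invariant `σ` of density `n` with `e^{tt'}(σ) ≤ energyDensityTT' 1 tp U n + ε` has
`e_P(σ) ≤ (R − μ₀·n − lo + 4·eS.dev t'₀ + ε)/h`. On the typed boxes of record: La-214 M15 object E (anchor
`(−1/4, 79/10)`: `4·dev = 4·(1/20) = 1/5`) and Na-CCOC M36 object E (anchor `(−71/200, 71/10)`: `4·(11/200) = 11/50`).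
With box-p2's caps of record (`boxLa214E_M15_word_polcaps`: `R = −0.4130954130`; `boxCCOCE_M36_word_polcaps`:
`R = −0.3546462921`) the ABSENT(`< m₀`) budget is `h·m₀ > R − μ₀·n.lo∧hi − lo + 0.2` (resp. `+ 0.22`) — the ONE
missing input is a sourced floor `lo` at the anchor. Ceiling side only; nothing floors order. -/

/-- **Object-E form of the order word at the box's own filling.** Let `B` carry entries `eU, eS, eSS, eN` with
`eSS = [0, 0]` (object E), `eU.lo ≥ 0`, `0 < eN.lo`, `eN.hi < 2`; let S2 state the `_word_Icc` window `[L, R]` on the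
cell; let ONE sourced floor hold at the anchor, `lo ≤ e_src(t'₀, U₀, μ₀, h)`, `h > 0`. Then on `B`, for every `ε` and
every translation-invariant `σ` with `σ.density = p n` and `e^{tt'}(σ) ≤ energyDensityTT' 1 (p tp/t) (p U/t) (p n) + ε`:
`e_P(σ) ≤ (R − μ₀·(p n) − lo + 4·eS.dev t'₀ + max 0 (U₀ − eU.lo) + ε)/h`. [cite: KomaTasaki1994, §1] -/
theorem holdsOn_pairAmplitude_le_of_anchor_filling_objE {B : OneBandBox} {eU eS eSS eN : Entry}
    (hU : B .UOverT = some eU) (hS : B .tpOverT = some eS) (hSS : B .tppOverT = some eSS)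
    (hN : B .filling = some eN) (hU0 : 0 ≤ eU.encl.fst) (hN0 : 0 < eN.encl.fst) (hN2 : eN.encl.snd < 2)
    (hSS0 : eSS.encl.fst = 0) (hSS1 : eSS.encl.snd = 0)
    {L R : ℝ}
    (hE : ∀ θ ∈ Set.Icc (s2Lo eU eS eN) (s2Hi eU eS eN),
      L ≤ energyDensityTT' 1 (θ 1) (θ 0) (θ 2) ∧ energyDensityTT' 1 (θ 1) (θ 0) (θ 2) ≤ R)
    {t'₀ U₀ μ₀ h lo : ℝ} (hh : 0 < h) (hlo : lo ≤ dWaveSourceEnergyDensityTT' t'₀ U₀ μ₀ h) :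
    HoldsOn (fun p : OneBandCoord → ℝ => ∀ (ε : ℝ) (σ : InfVolFermionState 2), σ.IsTranslationInvariant →
      σ.density = p .filling →
      σ.meanEnergy (hubbardTTPrimeFermionInteraction 1 (p .tpOverT) (p .UOverT)) 1 ≤
        energyDensityTT' 1 (p .tpOverT) (p .UOverT) (p .filling) + ε →
      σ.meanEnergy (pairSourceInteraction dWaveFormFactor) 1 ≤
        (R - μ₀ * p .filling - lo + 4 * eS.dev t'₀ + max 0 (U₀ - ((eU.encl.fst : ℚ) : ℝ)) + ε) / h) B := by
  intro p hp ε σ hσ hρ hε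
  have hm : (max |eSS.encl.fst| |eSS.encl.snd| : ℚ) = 0 := by rw [hSS0, hSS1]; norm_num
  have h0 : p .tppOverT = 0 := by
    have hmem := mem_ratCast_iff.1 (hp _ _ hSS)
    rw [hSS0, hSS1] at hmem
    push_cast at hmem
    linarith [hmem.1, hmem.2]
  obtain ⟨hu0, hn0, hn2⟩ := mem_sideConditions hU hN hU0 hN0 hN2 hp
  have hk := holdsOn_pairAmplitude_le_of_anchor_filling hU hS hSS hN hU0 hN0 hN2 hE hh hlo p hp ε σ hσ hρ
  rw [hm, h0, hubbardTT'T''FermionInteraction_zero,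
    tiGroundEnergyDensityAt_hubbardTTPrime_eq_energyDensityTT'_of_one_le 1 (p .tpOverT) hu0 (by norm_num : (1 : ℝ) ≤ 2)
      hn0 hn2,
    σ.meanEnergy_hubbardTTPrime_eq_one 1 (p .tpOverT) (p .UOverT) (by norm_num : (1 : ℝ) ≤ 2)] at hk
  have hk' := hk hε
  have hc : (((0 : ℚ)) : ℝ) = 0 := by norm_num
  rw [hc, mul_zero, add_zero] at hk'
  exact hk'

/-- **La-214 M15, OBJECT E, anchor at the lower `U/t_eff` edge** `(t'₀, U₀) = (−1/4, 79/10)`, any `μ₀`: the box's own S2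
window `[L, R]` (shape of `boxLa214E_M15_energyWord`'s hypothesis) and ONE sourced floor `lo ≤ e_src(−1/4, 79/10, μ₀, h)`
give, on `boxLa214E_M15`, `e_P(σ) ≤ (R − μ₀·n − lo + 1/5 + ε)/h` for every translation-invariant `ε`-near canonical
minimiser of the `t–t'` model at the member's couplings and filling. [cite: KomaTasaki1994, §1] -/
theorem boxLa214E_M15_pairAmplitude_le_anchorLo_filling {L R μ₀ h lo : ℝ}
    (hE : ∀ θ ∈ Set.Icc (![79/10, -3/10, 171/200] : Fin 3 → ℝ) ![147/10, -1/5, 179/200],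
      L ≤ energyDensityTT' 1 (θ 1) (θ 0) (θ 2) ∧ energyDensityTT' 1 (θ 1) (θ 0) (θ 2) ≤ R)
    (hh : 0 < h) (hlo : lo ≤ dWaveSourceEnergyDensityTT' (-1/4) (79/10) μ₀ h) :
    HoldsOn (fun p : OneBandCoord → ℝ => ∀ (ε : ℝ) (σ : InfVolFermionState 2), σ.IsTranslationInvariant →
      σ.density = p .filling →
      σ.meanEnergy (hubbardTTPrimeFermionInteraction 1 (p .tpOverT) (p .UOverT)) 1 ≤
        energyDensityTT' 1 (p .tpOverT) (p .UOverT) (p .filling) + ε →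
      σ.meanEnergy (pairSourceInteraction dWaveFormFactor) 1 ≤ (R - μ₀ * p .filling - lo + 1/5 + ε) / h)
      boxLa214E_M15 := by
  have hk := holdsOn_pairAmplitude_le_of_anchor_filling_objE (B := boxLa214E_M15) (eU := la214E_M15_U)
    (eS := la214E_M15_tp) (eSS := la214E_M15_tpp) (eN := la214_M15_n) rfl rfl rfl rfl
    (by rw [la214E_M15_U, Entry.encl_ofEnds_fst]; norm_num)
    (by rw [la214_M15_n, Entry.encl_ofEnds_fst]; norm_num)
    (by rw [la214_M15_n, Entry.encl_ofEnds_snd]; norm_num)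
    (by rw [la214E_M15_tpp, Entry.encl_ofEnds_fst]) (by rw [la214E_M15_tpp, Entry.encl_ofEnds_snd])
    (L := L) (R := R) (by rw [la214E_M15_s2Lo, la214E_M15_s2Hi]; exact hE) hh hlo
  have hd : la214E_M15_tp.dev (-1/4) = 1/20 := by
    rw [la214E_M15_tp, Entry.dev_ofEnds]; norm_num [abs_of_nonpos, abs_of_nonneg]
  have hu : max 0 ((79/10 : ℝ) - (((la214E_M15_U.encl.fst : ℚ)) : ℝ)) = 0 := by
    rw [la214E_M15_U, Entry.encl_ofEnds_fst]; norm_num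
  rw [hd, hu] at hk
  intro p hp ε σ hσ hρ hε
  have h := hk p hp ε σ hσ hρ hε
  have h4 : R - μ₀ * p .filling - lo + 4 * (1/20 : ℝ) + 0 + ε = R - μ₀ * p .filling - lo + 1/5 + ε := by ring
  rwa [h4] at h

/-- **Na-CCOC M36, OBJECT E, anchor at the lower `U/t_eff` edge** `(t'₀, U₀) = (−71/200, 71/10)`: the box's S2 window
and ONE sourced floor `lo ≤ e_src(−71/200, 71/10, μ₀, h)` give, on `boxCCOCE_M36`,
`e_P(σ) ≤ (R − μ₀·n − lo + 11/50 + ε)/h`. [cite: KomaTasaki1994, §1] -/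
theorem boxCCOCE_M36_pairAmplitude_le_anchorLo_filling {L R μ₀ h lo : ℝ}
    (hE : ∀ θ ∈ Set.Icc (![71/10, -41/100, 22/25] : Fin 3 → ℝ) ![62/5, -3/10, 23/25],
      L ≤ energyDensityTT' 1 (θ 1) (θ 0) (θ 2) ∧ energyDensityTT' 1 (θ 1) (θ 0) (θ 2) ≤ R)
    (hh : 0 < h) (hlo : lo ≤ dWaveSourceEnergyDensityTT' (-71/200) (71/10) μ₀ h) :
    HoldsOn (fun p : OneBandCoord → ℝ => ∀ (ε : ℝ) (σ : InfVolFermionState 2), σ.IsTranslationInvariant →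
      σ.density = p .filling →
      σ.meanEnergy (hubbardTTPrimeFermionInteraction 1 (p .tpOverT) (p .UOverT)) 1 ≤
        energyDensityTT' 1 (p .tpOverT) (p .UOverT) (p .filling) + ε →
      σ.meanEnergy (pairSourceInteraction dWaveFormFactor) 1 ≤ (R - μ₀ * p .filling - lo + 11/50 + ε) / h)
      boxCCOCE_M36 := by
  have hk := holdsOn_pairAmplitude_le_of_anchor_filling_objE (B := boxCCOCE_M36) (eU := cCOCE_M36_U)
    (eS := cCOCE_M36_tp) (eSS := cCOCE_M36_tpp) (eN := cCOCE_M36_n) rfl rfl rfl rfl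
    (by rw [cCOCE_M36_U, Entry.encl_ofEnds_fst]; norm_num)
    (by rw [cCOCE_M36_n, Entry.encl_ofEnds_fst]; norm_num)
    (by rw [cCOCE_M36_n, Entry.encl_ofEnds_snd]; norm_num)
    (by rw [cCOCE_M36_tpp, Entry.encl_ofEnds_fst]) (by rw [cCOCE_M36_tpp, Entry.encl_ofEnds_snd])
    (L := L) (R := R) (by rw [cCOCE_M36_s2Lo, cCOCE_M36_s2Hi]; exact hE) hh hlo
  have hd : cCOCE_M36_tp.dev (-71/200) = 11/200 := by
    rw [cCOCE_M36_tp, Entry.dev_ofEnds]; norm_num [abs_of_nonpos, abs_of_nonneg]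
  have hu : max 0 ((71/10 : ℝ) - (((cCOCE_M36_U.encl.fst : ℚ)) : ℝ)) = 0 := by
    rw [cCOCE_M36_U, Entry.encl_ofEnds_fst]; norm_num
  rw [hd, hu] at hk
  intro p hp ε σ hσ hρ hε
  have h := hk p hp ε σ hσ hρ hε
  have h4 : R - μ₀ * p .filling - lo + 4 * (11/200 : ℝ) + 0 + ε = R - μ₀ * p .filling - lo + 11/50 + ε := by ring
  rwa [h4] at h

/-- **The ABSENT budget on the two object-E boxes of record with box-p2's caps** (bookkeeping): La-214 M15
`R = −0.4130954130`, `n ∈ [0.855, 0.895]`, cost `1/5`; Na-CCOC M36 `R = −0.3546462921`, `n ∈ [0.88, 0.92]`, cost `11/50`.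
For `μ₀ ≤ 0` the worst filling is `n.hi`: ABSENT(`< m₀`) needs `h·m₀ > R − μ₀·n.hi − lo + cost`, i.e. for La-214 M15
`h·m₀ + lo + 0.895·μ₀ > −0.2130954130` and for Na-CCOC M36 `h·m₀ + lo + 0.92·μ₀ > −0.1346462921`. [folklore] -/
theorem objE_absent_budget_bookkeeping :
    (-4130954130/10000000000 : ℝ) + 1/5 = -2130954130/10000000000 ∧
    (-3546462921/10000000000 : ℝ) + 11/50 = -1346462921/10000000000 := by
  norm_num

end Summit.Ventures.CertifiedManyBodySolver.Downfold

end
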